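import Summits.Ventures.PercRepro.CodeBoundEight
import Summits.Ventures.PercRepro.LineCChoice

/-!
# The ∃k contraction-monotonicity frame for three-type single-merge maps (candidate lemma)

`ThreeTypeContractionMonoChoice`: every monotone single-merge map with all three crossing-pair
types has SOME coordinate whose top facet does not increase the Lemma-B class sum `CS_B`.  This is
the ∃k form of LINE C restricted to the only maps where Lemma B is open: for maps with at most two
types Lemma B is the column lemma (`crossCount_le_topBotCount_of_not_threeTypes`), so the dimension
induction of `lemmaB_monotone_of_contractionMonoChoice` closes with the three-type hypothesis alone
(`lemmaB_singleMerge_of_threeTypeChoice`), and `C005_of_singleMergeLemmaB` turns it into C-005.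
Evidence (HOME/mining/p4/g5): for three-type single-merge maps the violation of the ∀k form is UNSAT
along every coordinate at `d = 8` (kit j165517) and in every coordinate class of the symmetry-reduced
encodings at `d = 9` (j165518–j165535); the «every coordinate violates» killers are UNSAT at `d = 8`
(j164980) and `d = 9` (j164994).  A CANDIDATE, not a theorem: the Props are stated so that a proof of
either is a proof of C-005.

**Scope (referee reading, ref-2 15:37Z).** Both Props quantify over ABSTRACT monotone single-merge
cube maps — a strictly larger class than the graph-induced maps `ρ ↦ markedPartition` that C-005
needs — so they are genuine strengthenings of what C-005 requires: a counterexample at some `d ≥ 10`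
would NOT refute C-005, and the SAT evidence above is evidence for the abstract class up to `d = 9`
only.  The Props are the first dimension-inductive statements on this cube that survive the
two-type counterexample to the unrestricted contraction monotonicity (LINE C, `d = 8`).
-/

namespace PercRepro

open Finset

/-- **∃k contraction monotonicity for three-type single-merge maps**: some top facet does not
increase `CS_B`. -/
def ThreeTypeContractionMonoChoice : Prop :=
  ∀ {S : Type} [Fintype S] [DecidableEq S] (c : Config S → Setoid (Fin 4)),
    Monotone c → SingleMergeMap c → ThreeTypes c → ∃ k : S, cubeSumB (facetTop c k) ≤ cubeSumB c

/-- **∀k contraction monotonicity for three-type single-merge maps** (the lead's (MC_B) restricted to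
three-type maps; false for two-type maps at `d = 8` (j155997), UNSAT-to-violate for three-type maps at
`d = 8` along every coordinate (kit j165517) and at `d = 9` in the coordinate classes tested so far). -/
def ThreeTypeContractionMono : Prop :=
  ∀ {S : Type} [Fintype S] [DecidableEq S] (c : Config S → Setoid (Fin 4)),
    Monotone c → SingleMergeMap c → ThreeTypes c → ∀ k : S, cubeSumB (facetTop c k) ≤ cubeSumB c

/-- A three-type map lives on a nonempty cube (its two crossing cells would coincide otherwise). -/
theorem nonempty_of_threeTypes {S : Type} [Fintype S] [DecidableEq S]
    {c : Config S → Setoid (Fin 4)} (h3 : ThreeTypes c) : Nonempty S := by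
  by_contra hS
  have hempty : IsEmpty S := not_nonempty_iff.1 hS
  obtain ⟨ω, hω, hωc⟩ := h3 0 1 (by decide)
  have hρ : ωᶜ = ω := funext fun s => hempty.elim s
  rw [hρ, hω] at hωc
  exact absurd (cross4_injective hωc) (by decide)

/-- The ∀k form implies the ∃k form. -/
theorem ThreeTypeContractionMonoChoice_of_mono (h : ThreeTypeContractionMono) :
    ThreeTypeContractionMonoChoice := by
  intro S _ _ c hc hsm h3
  obtain ⟨k⟩ := nonempty_of_threeTypes h3
  exact ⟨k, h c hc hsm h3 k⟩

/-- Lemma B (`0 ≤ CS_B`) for a monotone map with at most two crossing-pair types: the column lemma. -/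
theorem cubeSumB_nonneg_of_not_threeTypes {S : Type} [Fintype S] [DecidableEq S]
    (c : Config S → Setoid (Fin 4)) (hc : Monotone c) (h3 : ¬ ThreeTypes c) : 0 ≤ cubeSumB c := by
  have hB := crossCount_le_topBotCount_of_not_threeTypes c hc h3
  have h' : (crossCount cross4 c : ℝ) ≤ topBotCount c := by exact_mod_cast hB
  have hsum := sum_crossKernel_compl cross4_injective c
  unfold cubeSumB cubeSum
  rw [show (∑ ρ : Config S, nestedKernel (c ρ) (c ρᶜ)) =
    ∑ ρ : Config S, crossKernel cross4 (c ρ) (c ρᶜ) from rfl, hsum]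
  linarith

/-- **The three-type ∃k form gives Lemma B for every single-merge map** (dimension induction; the
two-type case is the column lemma, the three-type case contracts the chosen coordinate). -/
theorem lemmaB_singleMerge_of_threeTypeChoice (h : ThreeTypeContractionMonoChoice) :
    ∀ {S : Type} [Fintype S] [DecidableEq S] (c : Config S → Setoid (Fin 4)), Monotone c →
      SingleMergeMap c → 0 ≤ cubeSumB c := by
  intro S _ _ c hc hsm
  suffices key : ∀ n : ℕ, ∀ (S : Type) [Fintype S] [DecidableEq S], Fintype.card S = n →
      ∀ c : Config S → Setoid (Fin 4), Monotone c → SingleMergeMap c → 0 ≤ cubeSumB c from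
    key _ S rfl c hc hsm
  intro n
  induction n with
  | zero =>
    intro S _ _ hS c _ _
    have hempty : IsEmpty S := Fintype.card_eq_zero_iff.mp hS
    unfold cubeSumB cubeSum
    refine Finset.sum_nonneg fun ρ _ => ?_
    have hρ : ρᶜ = ρ := funext fun s => hempty.elim s
    rw [hρ, nestedKernel_self]
  | succ n ih =>
    intro S _ _ hS c hc hsm
    by_cases h3 : ThreeTypes c
    · obtain ⟨k, hk⟩ := h c hc hsm h3
      have hcard : Fintype.card {s // s ≠ k} = n := by
        have := Fintype.card_subtype_compl (fun s : S => s = k)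
        rw [Fintype.card_subtype_eq, hS] at this
        simpa using this
      exact le_trans (ih _ hcard (facetTop c k) (facetTop_monotone hc k)
        (facetTop_singleMergeMap hsm k)) hk
    · exact cubeSumB_nonneg_of_not_threeTypes c hc h3

/-- **The three-type ∃k form closes C-005.** -/
theorem C005_of_threeTypeChoice (h : ThreeTypeContractionMonoChoice) : C005 := by
  intro V E _ _ G p hp a b c d
  have key : 0 ≤ nestedForm p (fun ω => G.markedPartition ω ![a, b, c, d])
      (fun ω => G.markedPartition ω ![a, b, c, d]) := by
    rw [nestedForm_self_eq_sum_faces]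
    refine Finset.sum_nonneg fun uv _ => ?_
    refine mul_nonneg (mul_nonneg (weight_nonneg hp _) (weight_nonneg hp _)) ?_
    split_ifs with hle
    · have hsm := G.singleMergeMap_class ![a, b, c, d] uv.1 uv.2
      have hmono : Monotone (fun ρ : Config (Face uv.1 uv.2) =>
          G.markedPartition (embed uv.1 uv.2 ρ) ![a, b, c, d]) :=
        (G.monotone_markedPartition_four ![a, b, c, d]).comp (embed_mono uv.1 uv.2)
      have hh := lemmaB_singleMerge_of_threeTypeChoice h _ hmono hsm
      unfold cubeSumB cubeSum at hh
      exact hh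
    · exact le_rfl
  rw [G.nestedForm_markedPartition] at key
  linarith

/-- **The three-type ∀k form closes C-005** (through the ∃k form). -/
theorem C005_of_threeTypeMono (h : ThreeTypeContractionMono) : C005 :=
  C005_of_threeTypeChoice (ThreeTypeContractionMonoChoice_of_mono h)

end PercRepro
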